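import Literature.NumberTheory.LFunctions.ClassGroupLFunctionLogDerivLeft
import HarnessLib

/-!
# Deuring–Heilbronn for class group `L`-functions: three elementary estimates

Topic `Literature/NumberTheory/LFunctions` (namespace `Literature.NumberTheory.LFunctions.NumberField.DH`).
Everything here is PROVED (theorems only).  The three estimates of [cite: ThornerZaman2017, §7.2] that do not
involve zeros:

* `norm_inv_pow_sub_inv_pow_le` — the near-cancellation of the pole of `ζ_K` against the exceptional zero:
  `‖a^{−N} − (a + δ)^{−N}‖ ≤ N δ` for `Re a ≥ 1`, `δ ≥ 0` (TZ: `|(α+it)^{−2m} − (α+it+1−β₁)^{−2m}| ≪ α^{−2m−1} m (1−β₁)`);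
* `exists_re_pole_gamma_le` — on the line `Re s = 2`: `Re[2/s + 2/(s−1) + 2γ_K'/γ_K(s)] ≤ 3 + log|d_K| + n_K (A₀ + 2 log(|t| + 2))`
  with an absolute `A₀` (Stirling for `ψ` on the vertical lines `Re = 1, 2`), the archimedean part of the `M`-bound
  [cite: ThornerZaman2017, Lemma 7.4];
* `dh_final_step` — the final optimisation: from `e^{−26 M x} ≤ C M δ₁` with `1 ≤ M ≤ M₁`, `x ≥ 0`:
  `x ≥ log(1/(C M₁ δ₁)) / (26 M₁)` [cite: ThornerZaman2017, §7.2 (7.13)].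

## References

* J. Thorner, A. Zaman, Algebra Number Theory 11 (2017), §7. [ThornerZaman2017]
-/

noncomputable section

open scoped NumberField Real
open Complex Filter Topology Set NumberField NumberField.InfinitePlace

namespace Literature.NumberTheory.LFunctions.NumberField

namespace DH

/-! ### `‖a^{−N} − (a+δ)^{−N}‖ ≤ N δ` -/

/-- `‖(a+δ)^N − a^N‖ ≤ N δ ‖a+δ‖^{N−1}` for `Re a ≥ 0`, `δ ≥ 0` (so `‖a‖ ≤ ‖a + δ‖`). [folklore] -/
theorem norm_pow_add_sub_pow_le {a : ℂ} (ha : 0 ≤ a.re) {δ : ℝ} (hδ : 0 ≤ δ) (N : ℕ) :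
    ‖(a + δ) ^ N - a ^ N‖ ≤ N * δ * ‖a + δ‖ ^ (N - 1) := by
  have hle : ‖a‖ ≤ ‖a + δ‖ := by
    rw [Complex.norm_def, Complex.norm_def]
    apply Real.sqrt_le_sqrt
    rw [Complex.normSq_apply, Complex.normSq_apply]
    simp only [add_re, ofReal_re, add_im, ofReal_im, add_zero]
    nlinarith
  rw [← Commute.geom_sum₂_mul (Commute.all _ _), norm_mul]
  have hdiff : ‖a + δ - a‖ = δ := by simp [abs_of_nonneg hδ]
  rw [hdiff]
  calc ‖∑ i ∈ Finset.range N, (a + δ) ^ i * a ^ (N - 1 - i)‖ * δ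
      ≤ (∑ i ∈ Finset.range N, ‖a + δ‖ ^ (N - 1)) * δ := by
        gcongr
        refine (norm_sum_le _ _).trans (Finset.sum_le_sum fun i hi ↦ ?_)
        rw [Finset.mem_range] at hi
        rw [norm_mul, norm_pow, norm_pow]
        calc ‖a + δ‖ ^ i * ‖a‖ ^ (N - 1 - i) ≤ ‖a + δ‖ ^ i * ‖a + δ‖ ^ (N - 1 - i) := by gcongr
          _ = ‖a + δ‖ ^ (N - 1) := by rw [← pow_add]; congr 1; omega
    _ = N * δ * ‖a + δ‖ ^ (N - 1) := by rw [Finset.sum_const, Finset.card_range, nsmul_eq_mul]; ring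

/-- **`‖a^{−N} − (a + δ)^{−N}‖ ≤ N δ`** for `Re a ≥ 1` and `δ ≥ 0`: the pole term `(s−1)^{−2m}` and the
exceptional-zero term `(s−β₁)^{−2m}` nearly cancel. [cite: ThornerZaman2017, §7.2 (after (7.9))] -/
theorem norm_inv_pow_sub_inv_pow_le {a : ℂ} (ha : 1 ≤ a.re) {δ : ℝ} (hδ : 0 ≤ δ) (N : ℕ) :
    ‖(a ^ N)⁻¹ - ((a + δ) ^ N)⁻¹‖ ≤ N * δ := by
  have ha1 : 1 ≤ ‖a‖ := ha.trans (Complex.re_le_norm a)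
  have had1 : 1 ≤ ‖a + δ‖ := by
    have : 1 ≤ (a + δ).re := by simp; linarith
    exact this.trans (Complex.re_le_norm _)
  have ha0 : a ≠ 0 := fun h ↦ by rw [h, norm_zero] at ha1; linarith
  have had0 : a + δ ≠ 0 := fun h ↦ by rw [h, norm_zero] at had1; linarith
  rcases Nat.eq_zero_or_pos N with rfl | hN
  · simp
  have hexpr : (a ^ N)⁻¹ - ((a + δ) ^ N)⁻¹ = ((a + δ) ^ N - a ^ N) / (a ^ N * (a + δ) ^ N) := by
    field_simp
  rw [hexpr, norm_div, norm_mul, norm_pow, norm_pow]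
  have hden : 0 < ‖a‖ ^ N * ‖a + δ‖ ^ N := by positivity
  rw [div_le_iff₀ hden]
  calc ‖(a + δ) ^ N - a ^ N‖ ≤ N * δ * ‖a + δ‖ ^ (N - 1) := norm_pow_add_sub_pow_le (by linarith) hδ N
    _ ≤ N * δ * (‖a‖ ^ N * ‖a + δ‖ ^ N) := by
        have h1 : ‖a + δ‖ ^ (N - 1) ≤ ‖a + δ‖ ^ N := pow_le_pow_right₀ had1 (Nat.sub_le N 1)
        have h2 : ‖a + δ‖ ^ N ≤ ‖a‖ ^ N * ‖a + δ‖ ^ N :=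
          le_mul_of_one_le_left (by positivity) (one_le_pow₀ ha1)
        have hNδ : 0 ≤ (N : ℝ) * δ := by positivity
        nlinarith

/-- Real-part version: `Re[a^{−N} − (a+δ)^{−N}] ≤ N δ`. [folklore] -/
theorem re_inv_pow_sub_inv_pow_le {a : ℂ} (ha : 1 ≤ a.re) {δ : ℝ} (hδ : 0 ≤ δ) (N : ℕ) :
    ((a ^ N)⁻¹ - ((a + δ) ^ N)⁻¹).re ≤ N * δ :=
  (Complex.re_le_norm _).trans (norm_inv_pow_sub_inv_pow_le ha hδ N)

/-! ### The archimedean part of the `M`-bound on `Re s = 2` -/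

/-- `Re(2/s + 2/(s − 1)) ≤ 3` for `Re s = 2`. [folklore] -/
theorem re_two_div_add_le (t : ℝ) :
    ((2 : ℂ) / (2 + t * I) + 2 / (2 + t * I - 1)).re ≤ 3 := by
  have h1 : ((2 : ℂ) / (2 + t * I)).re = 4 / (4 + t ^ 2) := by
    rw [Complex.div_re]; simp [Complex.normSq_apply]; ring
  have h2 : ((2 : ℂ) / (2 + t * I - 1)).re = 2 / (1 + t ^ 2) := by
    have : (2 : ℂ) + t * I - 1 = 1 + t * I := by ring
    rw [this, Complex.div_re]; simp [Complex.normSq_apply]; ring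
  rw [add_re, h1, h2]
  have ht : 0 ≤ t ^ 2 := sq_nonneg t
  have e1 : 4 / (4 + t ^ 2) ≤ 1 := by rw [div_le_one (by positivity)]; linarith
  have e2 : 2 / (1 + t ^ 2) ≤ 2 := by rw [div_le_iff₀ (by positivity)]; nlinarith
  linarith

/-- `log(1 + |y|) ≤ log(|t| + 2)` for `|y| ≤ |t|`. [folklore] -/
theorem log_one_add_le {y t : ℝ} (h : |y| ≤ |t|) : Real.log (1 + |y|) ≤ Real.log (|t| + 2) :=
  Real.log_le_log (by positivity) (by linarith)

/-- **The archimedean part of the `M`-bound**: there is an absolute `A₀ ≥ 0` such that for every number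
field `K` and real `t`, at `s = 2 + it`,
`Re[2/s + 2/(s−1) + 2 γ_K'/γ_K(s)] ≤ 3 + log|d_K| + n_K (A₀ + 2 log(|t| + 2))`.
[cite: ThornerZaman2017, Lemma 7.4] -/
theorem exists_re_pole_gamma_le :
    ∃ A₀ : ℝ, 0 ≤ A₀ ∧ ∀ (K : Type*) [Field K] [NumberField K] (t : ℝ),
      ((2 : ℂ) / (2 + t * I) + 2 / (2 + t * I - 1) + 2 * logDeriv (dedekindGammaFactor K) (2 + t * I)).re ≤
        3 + Real.log ((discr K).natAbs : ℝ) + Module.finrank ℚ K * (A₀ + 2 * Real.log (|t| + 2)) := by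
  obtain ⟨C₁, hC₁⟩ := Literature.Analysis.SpecialFunctions.Complex.exists_norm_digamma_vertical_le
    (a := 1) one_pos
  obtain ⟨C₂, hC₂⟩ := Literature.Analysis.SpecialFunctions.Complex.exists_norm_digamma_vertical_le
    (a := 2) two_pos
  have hC₁0 : 0 ≤ C₁ := by have := (norm_nonneg _).trans (hC₁ 0); simpa using this
  have hC₂0 : 0 ≤ C₂ := by have := (norm_nonneg _).trans (hC₂ 0); simpa using this
  set Lπ : ℝ := ‖Complex.log π‖ with hLπ
  set L2π : ℝ := ‖Complex.log (2 * π)‖ with hL2π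
  -- `A₀ = 2 (Lπ + L2π + C₁ + C₂)`
  refine ⟨2 * (Lπ + L2π + C₁ + C₂), by positivity, fun K _ _ t ↦ ?_⟩
  set s : ℂ := 2 + t * I with hs
  have hsre : s.re = 2 := by simp [hs]
  have hs0 : ∀ m : ℕ, s ≠ -m := fun m h ↦ by
    have := congrArg Complex.re h; rw [hsre] at this; simp at this; linarith [(m.cast_nonneg : (0:ℝ) ≤ m)]
  have hs2 : ∀ m : ℕ, s / 2 ≠ -m := fun m h ↦ by
    have := congrArg Complex.re h; simp [hs] at this; linarith [(m.cast_nonneg : (0:ℝ) ≤ m)]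
  -- the gamma factor
  have hγ := logDeriv_dedekindGammaFactor (K := K) hs0
  have hR := LFunctions.logDeriv_Gammaℝ hs2
  have hCx := logDeriv_Gammaℂ hs0
  -- digamma bounds at `s/2 = 1 + (t/2) i` and `s = 2 + t i`
  have hψ1 : ‖digamma (s / 2)‖ ≤ C₁ + Real.log (|t| + 2) := by
    have : s / 2 = (1 : ℝ) + (t / 2 : ℝ) * I := by simp [hs]; ring
    rw [this]
    refine (hC₁ (t / 2)).trans ?_
    have : |t / 2| ≤ |t| := by rw [abs_div, abs_two]; linarith [abs_nonneg t]
    linarith [log_one_add_le this]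
  have hψ2 : ‖digamma s‖ ≤ C₂ + Real.log (|t| + 2) := by
    have : s = (2 : ℝ) + t * I := by simp [hs]
    rw [this]
    exact (hC₂ t).trans (by linarith [log_one_add_le (le_refl |t|)])
  have hRn : ‖logDeriv Gammaℝ s‖ ≤ Lπ + C₁ + Real.log (|t| + 2) := by
    rw [hR]
    calc ‖-Complex.log π / 2 + digamma (s / 2) / 2‖ ≤ ‖-Complex.log π / 2‖ + ‖digamma (s / 2) / 2‖ := norm_add_le _ _
      _ = Lπ / 2 + ‖digamma (s / 2)‖ / 2 := by rw [norm_div, norm_neg, norm_div]; simp [hLπ]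
      _ ≤ Lπ + C₁ + Real.log (|t| + 2) := by
          have hlog : 0 ≤ Real.log (|t| + 2) := Real.log_nonneg (by linarith [abs_nonneg t])
          have : 0 ≤ Lπ := norm_nonneg _
          linarith
  have hCn : ‖logDeriv Gammaℂ s‖ ≤ L2π + C₂ + Real.log (|t| + 2) := by
    rw [hCx]
    calc ‖-Complex.log (2 * π) + digamma s‖ ≤ ‖-Complex.log (2 * π)‖ + ‖digamma s‖ := norm_add_le _ _
      _ ≤ L2π + C₂ + Real.log (|t| + 2) := by rw [norm_neg, ← hL2π]; linarith
  -- the discriminant term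
  have hd1 : (1 : ℝ) ≤ ((discr K).natAbs : ℝ) := by
    exact_mod_cast Nat.one_le_iff_ne_zero.mpr (Int.natAbs_ne_zero.mpr (discr_ne_zero K))
  have hlogd : (Complex.log ((discr K).natAbs : ℂ) / 2).re = Real.log ((discr K).natAbs : ℝ) / 2 := by
    rw [show ((discr K).natAbs : ℂ) = (((discr K).natAbs : ℝ) : ℂ) by push_cast; rfl,
      ← Complex.ofReal_log (by linarith), ← Complex.ofReal_ofNat, ← Complex.ofReal_div, Complex.ofReal_re]
  -- assemble
  have hγre : (logDeriv (dedekindGammaFactor K) s).re ≤ Real.log ((discr K).natAbs : ℝ) / 2 +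
      (nrRealPlaces K : ℝ) * (Lπ + C₁ + Real.log (|t| + 2)) + (nrComplexPlaces K : ℝ) * (L2π + C₂ + Real.log (|t| + 2)) := by
    rw [hγ, add_re, add_re, hlogd]
    have e1 : ((nrRealPlaces K : ℂ) * logDeriv Gammaℝ s).re ≤ (nrRealPlaces K : ℝ) * (Lπ + C₁ + Real.log (|t| + 2)) := by
      calc ((nrRealPlaces K : ℂ) * logDeriv Gammaℝ s).re ≤ ‖(nrRealPlaces K : ℂ) * logDeriv Gammaℝ s‖ := Complex.re_le_norm _
        _ = (nrRealPlaces K : ℝ) * ‖logDeriv Gammaℝ s‖ := by rw [norm_mul]; simp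
        _ ≤ (nrRealPlaces K : ℝ) * (Lπ + C₁ + Real.log (|t| + 2)) := by gcongr
    have e2 : ((nrComplexPlaces K : ℂ) * logDeriv Gammaℂ s).re ≤ (nrComplexPlaces K : ℝ) * (L2π + C₂ + Real.log (|t| + 2)) := by
      calc ((nrComplexPlaces K : ℂ) * logDeriv Gammaℂ s).re ≤ ‖(nrComplexPlaces K : ℂ) * logDeriv Gammaℂ s‖ := Complex.re_le_norm _
        _ = (nrComplexPlaces K : ℝ) * ‖logDeriv Gammaℂ s‖ := by rw [norm_mul]; simp
        _ ≤ (nrComplexPlaces K : ℝ) * (L2π + C₂ + Real.log (|t| + 2)) := by gcongr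
    linarith
  have hn : (nrRealPlaces K : ℝ) + nrComplexPlaces K ≤ Module.finrank ℚ K := by
    have h := card_add_two_mul_card_eq_rank K
    have : nrRealPlaces K + nrComplexPlaces K ≤ Module.finrank ℚ K := by
      rw [nrRealPlaces, nrComplexPlaces] at *; omega
    exact_mod_cast this
  have hr1 : (0 : ℝ) ≤ nrRealPlaces K := Nat.cast_nonneg _
  have hr2 : (0 : ℝ) ≤ nrComplexPlaces K := Nat.cast_nonneg _
  have hlog : 0 ≤ Real.log (|t| + 2) := Real.log_nonneg (by linarith [abs_nonneg t])
  have hlogd0 : 0 ≤ Real.log ((discr K).natAbs : ℝ) := Real.log_nonneg hd1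
  have hpole : (2 / s + 2 / (s - 1)).re ≤ 3 := by rw [hs]; exact re_two_div_add_le t
  have h2 : (2 * logDeriv (dedekindGammaFactor K) s).re = 2 * (logDeriv (dedekindGammaFactor K) s).re := by
    rw [show (2 : ℂ) = ((2 : ℝ) : ℂ) by norm_num, Complex.re_ofReal_mul]
  rw [add_re, h2]
  have hLπ0 : 0 ≤ Lπ := norm_nonneg _
  have hL2π0 : 0 ≤ L2π := norm_nonneg _
  set L : ℝ := Real.log (|t| + 2) with hL
  have e1 : (nrRealPlaces K : ℝ) * (Lπ + C₁ + L) ≤ nrRealPlaces K * (Lπ + L2π + C₁ + C₂ + L) :=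
    mul_le_mul_of_nonneg_left (by linarith) hr1
  have e2 : (nrComplexPlaces K : ℝ) * (L2π + C₂ + L) ≤ nrComplexPlaces K * (Lπ + L2π + C₁ + C₂ + L) :=
    mul_le_mul_of_nonneg_left (by linarith) hr2
  have e3 : ((nrRealPlaces K : ℝ) + nrComplexPlaces K) * (Lπ + L2π + C₁ + C₂ + L) ≤
      Module.finrank ℚ K * (Lπ + L2π + C₁ + C₂ + L) :=
    mul_le_mul_of_nonneg_right hn (by positivity)
  nlinarith [hγre, hpole, e1, e2, e3]

/-! ### The final optimisation -/

/-- **The final step**: if `0 ≤ x`, `1 ≤ M ≤ M₁`, `0 < δ₁`, `0 < C` and `exp(−26 M x) ≤ C M δ₁`, then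
`log(1/(C M₁ δ₁)) / (26 M₁) ≤ x`. [cite: ThornerZaman2017, §7.2 (7.13)] -/
theorem dh_final_step {x M M₁ δ₁ C : ℝ} (hx : 0 ≤ x) (hM : 1 ≤ M) (hMM : M ≤ M₁) (hδ : 0 < δ₁) (hC : 0 < C)
    (h : Real.exp (-(26 * M * x)) ≤ C * M * δ₁) :
    Real.log (1 / (C * M₁ * δ₁)) / (26 * M₁) ≤ x := by
  have hM0 : 0 < M := by linarith
  have hM₁ : 0 < M₁ := by linarith
  by_contra hcon
  push Not at hcon
  -- then `x₀ := log(1/(C M₁ δ₁))/(26 M₁) > x ≥ 0`, so `C M₁ δ₁ < 1`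
  set u : ℝ := C * M₁ * δ₁ with hu
  have hu0 : 0 < u := by positivity
  have hlogpos : 0 < Real.log (1 / u) := by
    have : 0 < Real.log (1 / u) / (26 * M₁) := lt_of_le_of_lt hx hcon
    by_contra hneg; push Not at hneg
    have : Real.log (1 / u) / (26 * M₁) ≤ 0 := div_nonpos_of_nonpos_of_nonneg hneg (by positivity)
    linarith
  have hu1 : u < 1 := by
    rw [one_div, Real.log_inv] at hlogpos
    have : Real.log u < 0 := by linarith
    exact (Real.log_neg_iff hu0).mp this
  -- `exp(−26 M x) > exp(−26 M x₀) = u^{M/M₁} ≥ u`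
  have hlt : Real.exp (-(26 * M * (Real.log (1 / u) / (26 * M₁)))) < Real.exp (-(26 * M * x)) := by
    apply Real.exp_lt_exp.mpr
    have : 26 * M * x < 26 * M * (Real.log (1 / u) / (26 * M₁)) := by
      apply mul_lt_mul_of_pos_left hcon (by positivity)
    linarith
  have heq : Real.exp (-(26 * M * (Real.log (1 / u) / (26 * M₁)))) = u ^ (M / M₁) := by
    rw [Real.rpow_def_of_pos hu0, one_div, Real.log_inv]
    congr 1
    field_simp
  have hge : u ≤ u ^ (M / M₁) := by
    have h1 : M / M₁ ≤ 1 := (div_le_one hM₁).mpr hMM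
    calc u = u ^ (1 : ℝ) := (Real.rpow_one u).symm
      _ ≤ u ^ (M / M₁) := Real.rpow_le_rpow_of_exponent_ge hu0 hu1.le h1
  have hCM : C * M * δ₁ ≤ u := by
    rw [hu]; gcongr
  linarith [heq ▸ hlt]

end DH

end Literature.NumberTheory.LFunctions.NumberField

end
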